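import Summits.ABC.ABC.Theorems.CongruentialReceptacleTameLocalReceptacleKeyCellDefs
import Summits.ABC.ABC.Theorems.CongruentialReceptacleTameLocalReceptacleStubFalseOfMatching

/-!
# Crux `TameLocalReceptacle` (stmt-ABC-14354), line `grh-friable-cell-resolution`:
# key-cell structure ⇒ first-moment matching

Registered stub `stub_matchingFamilies_of_keyCells` of the checked skeleton
`Cruxes/TameLocalReceptacle/Lines/grh_friable_cell_resolution.lean` (lead `prover-line-stmt-ABC-14354-a1-0`):
`∀ κ, KeyCellStructure κ → MatchingFamilies κ`.

Pure finite-sum bookkeeping over the objects of `…TameLocalReceptacleDefs.lean` (`mean`, `datum`, `oddPartA/B/C`,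
`MatchingFamilies`) and `…TameLocalReceptacleKeyCellDefs.lean` (`Pos`, `mkDatum`, `keyWeight`, `intensity`, `cellMass`,
`oddPrimesBelow`, `classDiscrepancy`, `valuationDiscrepancy`, `KeyCellStructure`, `stub_admMass`):

* KEY-SUM IDENTITY (`oddPart_eq_keySum`): on an abc-triple the position-`P` odd part `Σ_{q ∣ m, q ≠ 2} w(q; D_q)` is the
  sum over all keys `(q; v; r, s, z)` (`q < Q` odd prime, `1 ≤ v ≤ V`, residues `< q`) of `w(key) · 𝟙[D_q = key]` — a prime
  factor `q` of the member `m` carries exactly one key (coprimality kills the two other valuations), and none otherwise;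
* FAMILY MEANS (`mean_oddPart_eq`): by linearity of `mean`, the family mean of the odd part is `Σ_keys w · intensity`;
* CELL BOUND (`cell_bound`): inside one valuation cell `(q, v)`, writing `I_F − I_G = (I_F − U_F) + (U_F − U_G) + (U_G − I_G)`
  with the class-uniform models `U = 𝟙[adm] · cellMass/(q−1)²`, the window bound `|w| ≤ keyWeight` and
  `#adm = (q−1)²` (`stub_admMass`) give `|Σ w (I_F − I_G)| ≤ Σ kW|I_F − U_F| + kW|cellMass F − cellMass G| + Σ kW|I_G − U_G|`;
* summing over cells: `|mean F − mean G| ≤ classDiscrepancy F + valuationDiscrepancy F G + classDiscrepancy G`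
  (`abs_mean_oddPart_sub_le`), each `≤ (δ/3)·N` by `KeyCellStructure` at `δ/3`.

The position-`P` odd part is written `Σ_{q ∈ (P.sel T).primeFactors ∖ {2}} evalAt w q (datum T q)` throughout; for
`P = A, B, C` it is `oddPartA/B/C` definitionally.  Helpers live in the sub-namespace `KeyCellBook`; `mean_congr` is the
one of `…StubFalseOfMatching.lean` (imported).
-/

-- `Summit.<Summit>.<Problem>` is the mandated summit-side namespace (CONVENTIONS §2); for the
-- single-conjunct summit `ABC` the two coincide, so the duplicate `ABC.ABC` is deliberate.
set_option linter.dupNamespace false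

noncomputable section

namespace Summit.ABC.ABC.Theorems.TameLocalReceptacle

open Finset Literature.NumberTheory.DiophantineGeometry

namespace KeyCellBook

/-! ### Linearity of the family mean -/

/-- The mean of a finite sum is the sum of the means. [folklore] -/
theorem mean_finset_sum {ι : Type*} (F : Finset (ℕ × ℕ × ℕ)) (S : Finset ι) (g : ι → ℕ × ℕ × ℕ → ℝ) :
    mean F (fun T => ∑ i ∈ S, g i T) = ∑ i ∈ S, mean F (g i) := by
  simp only [mean, Finset.sum_div]
  exact Finset.sum_comm

/-- The mean is homogeneous. [folklore] -/
theorem mean_const_mul (F : Finset (ℕ × ℕ × ℕ)) (c : ℝ) (g : ℕ × ℕ × ℕ → ℝ) :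
    mean F (fun T => c * g T) = c * mean F g := by
  simp only [mean, ← Finset.mul_sum, mul_div_assoc]

/-- Triangle inequality for a finite sum against pointwise bounds. [folklore] -/
theorem abs_sum_le_of_le {ι : Type*} {s : Finset ι} {f g : ι → ℝ} (h : ∀ i ∈ s, |f i| ≤ g i) :
    |∑ i ∈ s, f i| ≤ ∑ i ∈ s, g i :=
  (Finset.abs_sum_le_sum_abs f s).trans (Finset.sum_le_sum h)

/-! ### The position-`P` odd part and the key-sum identity -/

/-- Keys are determined by valuation and residues: `(v; r, s, z) ↦ mkDatum (P.exps v) r s z` is injective. [folklore] -/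
theorem mkDatum_exps_inj (P : Pos) {v r s z v' r' s' z' : ℕ} :
    mkDatum (P.exps v) r s z = mkDatum (P.exps v') r' s' z' ↔ v = v' ∧ r = r' ∧ s = s' ∧ z = z' := by
  cases P <;> simp [mkDatum, Pos.exps]

/-- A sum over the key box of `g · 𝟙[key₀ = key]` picks out the value at `key₀`. [folklore] -/
theorem sum_box_single (P : Pos) {M q v₀ r₀ s₀ z₀ : ℕ} (hv : v₀ ∈ Icc 1 M) (hr : r₀ ∈ range q)
    (hs : s₀ ∈ range q) (hz : z₀ ∈ range q) (g : ℕ → ℕ → ℕ → ℕ → ℝ) :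
    ∑ v ∈ Icc 1 M, ∑ r ∈ range q, ∑ s ∈ range q, ∑ z ∈ range q,
      g v r s z * (if mkDatum (P.exps v₀) r₀ s₀ z₀ = mkDatum (P.exps v) r s z then (1 : ℝ) else 0) =
      g v₀ r₀ s₀ z₀ := by
  simp only [mkDatum_exps_inj]
  rw [Finset.sum_eq_single_of_mem v₀ hv, Finset.sum_eq_single_of_mem r₀ hr,
    Finset.sum_eq_single_of_mem s₀ hs, Finset.sum_eq_single_of_mem z₀ hz]
  · simp
  all_goals intro x _ hx; simp [Ne.symm hx]

/-- On an abc-triple, the datum at a prime factor `q` of the member in position `P` is a key of that position: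
valuation `v = v_q(member) ∈ [1, M]` (for `member < M`), the two other valuations vanish, residues `< q`. [folklore] -/
theorem exists_key (P : Pos) {T : ℕ × ℕ × ℕ} (hT : IsABCTriple T.1 T.2.1 T.2.2) {q M : ℕ}
    (hq : q ∈ (P.sel T).primeFactors) (hM : P.sel T < M) :
    ∃ v₀ ∈ Icc 1 M, ∃ r₀ ∈ range q, ∃ s₀ ∈ range q, ∃ z₀ ∈ range q,
      datum T.1 T.2.1 T.2.2 q = mkDatum (P.exps v₀) r₀ s₀ z₀ := by
  have hqp : q.Prime := Nat.prime_of_mem_primeFactors hq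
  have hm0 : P.sel T ≠ 0 := (Nat.mem_primeFactors.1 hq).2.2
  have hlt : ∀ n : ℕ, n % q ∈ range q := fun n => mem_range.2 (Nat.mod_lt n hqp.pos)
  -- a prime outside `n.primeFactors` has valuation `0` (cf. `HeathBrown2001.factorization_eq_zero_of_not_mem`)
  have fz : ∀ {n : ℕ}, q ∉ n.primeFactors → n.factorization q = 0 := fun h =>
    Finsupp.notMem_support_iff.1 (by rwa [Nat.support_factorization])
  refine ⟨(P.sel T).factorization q, mem_Icc.2 ⟨hqp.factorization_pos_of_dvd hm0 (Nat.dvd_of_mem_primeFactors hq),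
    ((Nat.factorization_lt q hm0).trans hM).le⟩, T.1 / q ^ T.1.factorization q % q, hlt _,
    T.2.1 / q ^ T.2.1.factorization q % q, hlt _, T.2.2 / q ^ T.2.2.factorization q % q, hlt _, ?_⟩
  obtain ⟨-, -, habc, hab⟩ := hT
  have hac : Nat.Coprime T.1 T.2.2 := by rw [← habc]; exact Nat.coprime_self_add_right.mpr hab
  have hbc : Nat.Coprime T.2.1 T.2.2 := by rw [← habc]; exact Nat.coprime_add_self_right.mpr hab.symm
  cases P with
  | A =>
    have h1 := fz (disjoint_left.1 hab.disjoint_primeFactors hq)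
    have h2 := fz (disjoint_left.1 hac.disjoint_primeFactors hq)
    simp [datum, mkDatum, Pos.exps, Pos.sel, h1, h2]
  | B =>
    have h1 := fz (disjoint_right.1 hab.disjoint_primeFactors hq)
    have h2 := fz (disjoint_left.1 hbc.disjoint_primeFactors hq)
    simp [datum, mkDatum, Pos.exps, Pos.sel, h1, h2]
  | C =>
    have h1 := fz (disjoint_right.1 hac.disjoint_primeFactors hq)
    have h2 := fz (disjoint_right.1 hbc.disjoint_primeFactors hq)
    simp [datum, mkDatum, Pos.exps, Pos.sel, h1, h2]

/-- The odd primes below `M` meet the prime factors of `m < M` in the odd prime factors of `m`. [folklore] -/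
theorem oddPrimesBelow_inter {m M : ℕ} (hm : m < M) :
    oddPrimesBelow M ∩ m.primeFactors = m.primeFactors.erase 2 := by
  ext q
  simp only [oddPrimesBelow, Finset.mem_inter, Finset.mem_filter, Finset.mem_range, Finset.mem_erase]
  constructor
  · rintro ⟨⟨-, -, h2⟩, h⟩
    exact ⟨h2, h⟩
  · rintro ⟨h2, h⟩
    exact ⟨⟨(Nat.le_of_mem_primeFactors h).trans_lt hm, Nat.prime_of_mem_primeFactors h, h2⟩, h⟩

/-- A member of `oddPrimesBelow M` is prime. [folklore] -/
theorem prime_of_mem_oddPrimesBelow {q M : ℕ} (h : q ∈ oddPrimesBelow M) : q.Prime :=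
  (Finset.mem_filter.1 h).2.1

/-- **Key-sum identity.** On an abc-triple whose position-`P` member is `< M`, the position-`P` odd part is the sum over
all keys `(q; v; r, s, z)` (`q < M` odd prime, `1 ≤ v ≤ M`, residues `< q`) of `w(key) · 𝟙[q ∣ member ∧ D_q = key]`. [folklore] -/
theorem oddPart_eq_keySum (P : Pos) (w : RTable) {T : ℕ × ℕ × ℕ} (hT : IsABCTriple T.1 T.2.1 T.2.2) {M : ℕ}
    (hM : P.sel T < M) :
    ∑ q ∈ (P.sel T).primeFactors.erase 2, evalAt w q (datum T.1 T.2.1 T.2.2 q) =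
      ∑ q ∈ oddPrimesBelow M, ∑ v ∈ Icc 1 M, ∑ r ∈ range q, ∑ s ∈ range q, ∑ z ∈ range q,
      evalAt w q (mkDatum (P.exps v) r s z) *
        (if q ∈ (P.sel T).primeFactors ∧ datum T.1 T.2.1 T.2.2 q = mkDatum (P.exps v) r s z
          then (1 : ℝ) else 0) := by
  have inner : ∀ q ∈ oddPrimesBelow M, (∑ v ∈ Icc 1 M, ∑ r ∈ range q, ∑ s ∈ range q, ∑ z ∈ range q,
      evalAt w q (mkDatum (P.exps v) r s z) *
        (if q ∈ (P.sel T).primeFactors ∧ datum T.1 T.2.1 T.2.2 q = mkDatum (P.exps v) r s z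
          then (1 : ℝ) else 0)) =
      if q ∈ (P.sel T).primeFactors then evalAt w q (datum T.1 T.2.1 T.2.2 q) else 0 := by
    intro q _
    by_cases hq : q ∈ (P.sel T).primeFactors
    · obtain ⟨v₀, hv, r₀, hr, s₀, hs, z₀, hz, hD⟩ := exists_key P hT hq hM
      rw [if_pos hq]
      simp only [hq, true_and, hD]
      exact sum_box_single P hv hr hs hz (fun v r s z => evalAt w q (mkDatum (P.exps v) r s z))
    · simp [hq]
  rw [Finset.sum_congr rfl inner, Finset.sum_ite_mem, oddPrimesBelow_inter hM]

/-- **Family means as key sums.** For a family of abc-triples with position-`P` members `< M`, the mean of the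
position-`P` odd part is `Σ_keys w(key) · intensity F P (key)`. [folklore] -/
theorem mean_oddPart_eq (P : Pos) (w : RTable) {F : Finset (ℕ × ℕ × ℕ)} {M : ℕ}
    (hF : ∀ T ∈ F, IsABCTriple T.1 T.2.1 T.2.2) (hM : ∀ T ∈ F, P.sel T < M) :
    mean F (fun T => ∑ q ∈ (P.sel T).primeFactors.erase 2, evalAt w q (datum T.1 T.2.1 T.2.2 q)) =
      ∑ q ∈ oddPrimesBelow M, ∑ v ∈ Icc 1 M, ∑ r ∈ range q, ∑ s ∈ range q, ∑ z ∈ range q,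
      evalAt w q (mkDatum (P.exps v) r s z) * intensity F P q (mkDatum (P.exps v) r s z) := by
  rw [mean_congr (fun T hT => oddPart_eq_keySum P w (hF T hT) (hM T hT))]
  simp only [mean_finset_sum, mean_const_mul]
  rfl

/-! ### The bound inside one valuation cell -/

/-- **Cell bound.** Inside the valuation cell `(q, v)` (`q` prime), for a window-bounded weight,
`|Σ_{r,s,z} w · (I_F − I_G)| ≤ Σ kW |I_F − U_F| + kW |cellMass F − cellMass G| + Σ kW |I_G − U_G|`, where
`U = 𝟙[adm] · cellMass/(q−1)²` is the class-uniform model and `kW = keyWeight (P.exps v) q`; the middle term uses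
`#adm = (q−1)²` (`stub_admMass`). [folklore] -/
theorem cell_bound (P : Pos) {w : RTable} (hw : WindowBounded w) (F G : Finset (ℕ × ℕ × ℕ)) {q : ℕ}
    (hq : q.Prime) (v : ℕ) :
    |∑ r ∈ range q, ∑ s ∈ range q, ∑ z ∈ range q,
        (evalAt w q (mkDatum (P.exps v) r s z) * intensity F P q (mkDatum (P.exps v) r s z) -
          evalAt w q (mkDatum (P.exps v) r s z) * intensity G P q (mkDatum (P.exps v) r s z))| ≤
      (∑ r ∈ range q, ∑ s ∈ range q, ∑ z ∈ range q, keyWeight (P.exps v) q *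
          |intensity F P q (mkDatum (P.exps v) r s z) -
            (if P.adm q r s z then cellMass F P q v / (((q : ℝ) - 1) ^ 2) else 0)|) +
        keyWeight (P.exps v) q * |cellMass F P q v - cellMass G P q v| +
        ∑ r ∈ range q, ∑ s ∈ range q, ∑ z ∈ range q, keyWeight (P.exps v) q *
          |intensity G P q (mkDatum (P.exps v) r s z) -
            (if P.adm q r s z then cellMass G P q v / (((q : ℝ) - 1) ^ 2) else 0)| := by
  have hq1 : (0 : ℝ) < ((q : ℝ) - 1) ^ 2 := by
    have h2 : (2 : ℝ) ≤ q := by exact_mod_cast hq.two_le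
    exact pow_pos (by linarith) 2
  -- pointwise three-term bound
  have hpt : ∀ r s z : ℕ,
      |evalAt w q (mkDatum (P.exps v) r s z) * intensity F P q (mkDatum (P.exps v) r s z) -
          evalAt w q (mkDatum (P.exps v) r s z) * intensity G P q (mkDatum (P.exps v) r s z)| ≤
        keyWeight (P.exps v) q *
            |intensity F P q (mkDatum (P.exps v) r s z) -
              (if P.adm q r s z then cellMass F P q v / (((q : ℝ) - 1) ^ 2) else 0)| +
          keyWeight (P.exps v) q * |cellMass F P q v - cellMass G P q v| / (((q : ℝ) - 1) ^ 2) *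
            (if P.adm q r s z then (1 : ℝ) else 0) +
          keyWeight (P.exps v) q *
            |intensity G P q (mkDatum (P.exps v) r s z) -
              (if P.adm q r s z then cellMass G P q v / (((q : ℝ) - 1) ^ 2) else 0)| := by
    intro r s z
    set W := evalAt w q (mkDatum (P.exps v) r s z)
    set I₁ := intensity F P q (mkDatum (P.exps v) r s z)
    set I₂ := intensity G P q (mkDatum (P.exps v) r s z)
    set U₁ := (if P.adm q r s z then cellMass F P q v / (((q : ℝ) - 1) ^ 2) else 0) with hU₁
    set U₂ := (if P.adm q r s z then cellMass G P q v / (((q : ℝ) - 1) ^ 2) else 0) with hU₂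
    have hW : |W| ≤ keyWeight (P.exps v) q := hw q (P.exps v).1 (P.exps v).2.1 (P.exps v).2.2 r s z hq
    have hmid : |W| * |U₁ - U₂| ≤ keyWeight (P.exps v) q * |cellMass F P q v - cellMass G P q v| /
        (((q : ℝ) - 1) ^ 2) * (if P.adm q r s z then (1 : ℝ) else 0) := by
      by_cases ha : P.adm q r s z = true
      · rw [hU₁, hU₂, if_pos ha, if_pos ha, if_pos ha, mul_one, ← sub_div, abs_div, abs_of_pos hq1,
          mul_div_assoc]
        exact mul_le_mul_of_nonneg_right hW (div_nonneg (abs_nonneg _) hq1.le)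
      · rw [hU₁, hU₂, if_neg ha, if_neg ha, if_neg ha]
        simp
    calc |W * I₁ - W * I₂| = |W * (I₁ - U₁) + W * (U₁ - U₂) + W * (U₂ - I₂)| := by congr 1; ring
      _ ≤ |W * (I₁ - U₁)| + |W * (U₁ - U₂)| + |W * (U₂ - I₂)| := abs_add_three _ _ _
      _ = |W| * |I₁ - U₁| + |W| * |U₁ - U₂| + |W| * |I₂ - U₂| := by
          rw [abs_mul, abs_mul, abs_mul, abs_sub_comm U₂ I₂]
      _ ≤ _ := add_le_add_three (mul_le_mul_of_nonneg_right hW (abs_nonneg _)) hmid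
            (mul_le_mul_of_nonneg_right hW (abs_nonneg _))
  refine (abs_sum_le_of_le fun r _ => abs_sum_le_of_le fun s _ => abs_sum_le_of_le fun z _ =>
    hpt r s z).trans (le_of_eq ?_)
  simp only [Finset.sum_add_distrib, ← Finset.mul_sum]
  rw [stub_admMass P q hq.one_le, div_mul_cancel₀ _ hq1.ne']

/-- **The triangle inequality through the class-uniform models.** For two families of `κ`-balanced triples and a
window-bounded weight, with the truncation `Q = V = M := 1 + max` of the position-`P` members,
`|mean F (odd part) − mean G (odd part)| ≤ classDiscrepancy F + valuationDiscrepancy F G + classDiscrepancy G`.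
[folklore] -/
theorem abs_mean_oddPart_sub_le (P : Pos) {w : RTable} (hw : WindowBounded w) {κ : ℝ}
    {F G : Finset (ℕ × ℕ × ℕ)} (hF : ∀ T ∈ F, IsBalanced κ T.1 T.2.1 T.2.2)
    (hG : ∀ T ∈ G, IsBalanced κ T.1 T.2.1 T.2.2) :
    ∃ Q V : ℕ, |mean F (fun T => ∑ q ∈ (P.sel T).primeFactors.erase 2, evalAt w q (datum T.1 T.2.1 T.2.2 q)) -
        mean G (fun T => ∑ q ∈ (P.sel T).primeFactors.erase 2, evalAt w q (datum T.1 T.2.1 T.2.2 q))| ≤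
      classDiscrepancy F P Q V + valuationDiscrepancy F G P Q V + classDiscrepancy G P Q V := by
  obtain ⟨M, hFM, hGM⟩ : ∃ M : ℕ, (∀ T ∈ F, P.sel T < M) ∧ (∀ T ∈ G, P.sel T < M) :=
    ⟨(F ∪ G).sup P.sel + 1,
      fun T hT => Nat.lt_succ_of_le (Finset.le_sup (f := P.sel) (Finset.mem_union_left G hT)),
      fun T hT => Nat.lt_succ_of_le (Finset.le_sup (f := P.sel) (Finset.mem_union_right F hT))⟩
  refine ⟨M, M, ?_⟩
  rw [mean_oddPart_eq P w (fun T hT => (hF T hT).1) hFM, mean_oddPart_eq P w (fun T hT => (hG T hT).1) hGM]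
  simp only [← Finset.sum_sub_distrib]
  unfold classDiscrepancy valuationDiscrepancy
  refine (abs_sum_le_of_le fun q hq => abs_sum_le_of_le fun v _ =>
    cell_bound P hw F G (prime_of_mem_oddPrimesBelow hq) v).trans (le_of_eq ?_)
  simp only [Finset.sum_add_distrib]

end KeyCellBook

open KeyCellBook

/-- **Registered stub `stub_matchingFamilies_of_keyCells`** (line `grh-friable-cell-resolution` of crux stmt-ABC-14354):
key-cell structure implies first-moment matching.  Given `κ` and `⟨V₀, h⟩ := KeyCellStructure κ`, for `δ > 0` and
`N₁` apply `h` at `δ/3`; the families and shape clauses are reused verbatim, and each of the nine matching lines is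
`abs_mean_oddPart_sub_le` (`≤ classDiscrepancy + valuationDiscrepancy + classDiscrepancy`) followed by the (CE)/(VM)
clauses at the truncation it produces (`3 · (δ/3)·N = δ·N`). [folklore] -/
theorem stub_matchingFamilies_of_keyCells : ∀ κ : ℝ, KeyCellStructure κ → MatchingFamilies κ := by
  rintro κ ⟨V₀, h⟩
  refine ⟨V₀, fun δ hδ N₁ => ?_⟩
  obtain ⟨N, hN, FA, FB, FC, G, G', hFA0, hFB0, hFC0, hG0, hG'0, hFA, hFB, hFC, hG, hG', hCE, hVM⟩ :=
    h (δ / 3) (by positivity) N₁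
  refine ⟨N, hN, FA, FB, FC, G, G', hFA0, hFB0, hFC0, hG0, hG'0, hFA, hFB, hFC, hG, hG', fun w hw => ?_⟩
  -- the generic step: (★) + the three discrepancy clauses
  have key : ∀ (P : Pos) {F₁ F₂ : Finset (ℕ × ℕ × ℕ)},
      (∀ T ∈ F₁, IsBalanced κ T.1 T.2.1 T.2.2) → (∀ T ∈ F₂, IsBalanced κ T.1 T.2.1 T.2.2) →
      (∀ Q V : ℕ, classDiscrepancy F₁ P Q V ≤ δ / 3 * N) →
      (∀ Q V : ℕ, valuationDiscrepancy F₁ F₂ P Q V ≤ δ / 3 * N) →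
      (∀ Q V : ℕ, classDiscrepancy F₂ P Q V ≤ δ / 3 * N) →
      |mean F₁ (fun T => ∑ q ∈ (P.sel T).primeFactors.erase 2, evalAt w q (datum T.1 T.2.1 T.2.2 q)) -
          mean F₂ (fun T => ∑ q ∈ (P.sel T).primeFactors.erase 2, evalAt w q (datum T.1 T.2.1 T.2.2 q))| ≤ δ * N := by
    intro P F₁ F₂ h₁ h₂ c₁ c₂ c₃
    obtain ⟨Q, V, hQV⟩ := abs_mean_oddPart_sub_le P hw h₁ h₂
    linarith [c₁ Q V, c₂ Q V, c₃ Q V]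
  have bA : ∀ T ∈ FA, IsBalanced κ T.1 T.2.1 T.2.2 := fun T hT => (hFA T hT).1
  have bB : ∀ T ∈ FB, IsBalanced κ T.1 T.2.1 T.2.2 := fun T hT => (hFB T hT).1
  have bC : ∀ T ∈ FC, IsBalanced κ T.1 T.2.1 T.2.2 := fun T hT => (hFC T hT).1
  have bG : ∀ T ∈ G, IsBalanced κ T.1 T.2.1 T.2.2 := fun T hT => (hG T hT).1
  have bG' : ∀ T ∈ G', IsBalanced κ T.1 T.2.1 T.2.2 := fun T hT => (hG' T hT).1
  exact ⟨key Pos.A bA bG' (fun Q V => (hCE Pos.A Q V).1) (fun Q V => (hVM Q V).1)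
      (fun Q V => (hCE Pos.A Q V).2.2.2.2),
    key Pos.B bA bG (fun Q V => (hCE Pos.B Q V).1) (fun Q V => (hVM Q V).2.1)
      (fun Q V => (hCE Pos.B Q V).2.2.2.1),
    key Pos.C bA bG (fun Q V => (hCE Pos.C Q V).1) (fun Q V => (hVM Q V).2.2.1)
      (fun Q V => (hCE Pos.C Q V).2.2.2.1),
    key Pos.A bB bG (fun Q V => (hCE Pos.A Q V).2.1) (fun Q V => (hVM Q V).2.2.2.1)
      (fun Q V => (hCE Pos.A Q V).2.2.2.1),
    key Pos.B bB bG' (fun Q V => (hCE Pos.B Q V).2.1) (fun Q V => (hVM Q V).2.2.2.2.1)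
      (fun Q V => (hCE Pos.B Q V).2.2.2.2),
    key Pos.C bB bG (fun Q V => (hCE Pos.C Q V).2.1) (fun Q V => (hVM Q V).2.2.2.2.2.1)
      (fun Q V => (hCE Pos.C Q V).2.2.2.1),
    key Pos.A bC bG (fun Q V => (hCE Pos.A Q V).2.2.1) (fun Q V => (hVM Q V).2.2.2.2.2.2.1)
      (fun Q V => (hCE Pos.A Q V).2.2.2.1),
    key Pos.B bC bG (fun Q V => (hCE Pos.B Q V).2.2.1) (fun Q V => (hVM Q V).2.2.2.2.2.2.2.1)
      (fun Q V => (hCE Pos.B Q V).2.2.2.1),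
    key Pos.C bC bG' (fun Q V => (hCE Pos.C Q V).2.2.1) (fun Q V => (hVM Q V).2.2.2.2.2.2.2.2)
      (fun Q V => (hCE Pos.C Q V).2.2.2.2)⟩

end Summit.ABC.ABC.Theorems.TameLocalReceptacle

end
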